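import Summits.AtomisticToContinuum.Crystallization.Theorems.FrustratedLawDichotomyStrainedPatchHomExteriorLeaf

/-!
# Strained patch, `(H)` hcp exterior certificate (architecture R3) — E3: THE SIGNED-FLOOR EXTERIOR / ANNULUS LEAF `annulusOK` (chained curvature floors (β), critic row
# 1470 (A4)) and its soundness at every level (decomp-a2c hand 2, generation 39; structural #15)

`…HomExteriorLeaf.exteriorOK` (p854110) certifies a slab with ONE nonnegative floor `lmin` along the whole ray.  The annulus design (β) chains SIGNED per-box floors
(positive near the cell, possibly negative in the soft band `2e-2 … 4.5e-2`): the length-weighted sum `Λ ≥ Σ_k sgnFloor ℓ_k …` of `…HomExteriorRaySigned` (p854099) then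
needs CERTIFIED DWELL DATA — rationals `a_k = na_k/den ≤ θ_k ≤ b_k = nb_k/den` — which a Bool certifies by interval arithmetic on ONE coordinate formula: the ray point
`(1 − a)ξ₀ + aξ` has coordinate `j` in `[(1−a)(cC−wC) + a(c−w), (1−a)(cC+wC) + a(c+w)]/SC` (`ray_coord_mem_of_check`, `ray_coord_not_mem_of_check`).  Fields beyond
`exteriorOK`'s: per-box floors `ll : List ℤ` (Gershgorin each), `den`, `na nb : List ℤ` (length `m+1`, `na 0 = nb 0 = 0`, `na m = nb m = den`), and the domination
`4·SC²·den·8892·279936 + 4·SC·den·Gs·Z + 4·SC²·den·|R|·823543 < 3·g·Z·Σ_k sgnFloorZ …` (integers; `Z = 7⁷·6⁷`).  ★ `annulusOK_sound` (full `hver` shape, every `μ`)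
via `hver_exterior_of_curvChecks_signedFloor`.  0 sorry; standard axioms; computable defs.  `--supports stmt-AtomisticToContinuum-27623`.
-/

noncomputable section

open Set

namespace Summit.AtomisticToContinuum.Crystallization.Theorems.FrustratedLawDichotomyStrainedPatchHomExteriorRay

open scoped BigOperators RealInnerProductSpace
open Literature.Analysis.ValidatedNumerics.Numerics
open Summit.AtomisticToContinuum.Crystallization.Theorems.ChargedEnergyGapNegative (E3)
open Summit.AtomisticToContinuum.Crystallization.Theorems.FrustratedLawDichotomySchurCut (effPot w₄₅ ω₄)
open Summit.AtomisticToContinuum.Crystallization.Theorems.FrustratedLawDichotomyAveragingRuleTightFree (TightNearCap BadNearCap)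
open Summit.AtomisticToContinuum.Crystallization.Theorems.FrustratedLawDichotomyExemptAbsorption (ExemptNear)
open Summit.AtomisticToContinuum.Crystallization.Theorems.FrustratedLawDichotomyStrainedPatchHomSplit (ExRec latPt hexFrame hcpShift)
open Summit.AtomisticToContinuum.Crystallization.Theorems.FrustratedLawDichotomyStrainedPatchTaylorChord (segGd)
open Summit.AtomisticToContinuum.Crystallization.Theorems.FrustratedLawDichotomyStrainedPatchHomCurvLeaf (nodup_filter_append toFinset_filter_append)
open Summit.AtomisticToContinuum.Crystallization.Theorems.FrustratedLawDichotomyStrainedPatchHomCurvLJ (curvCheckLJM ljLabelOK)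
open Summit.AtomisticToContinuum.Crystallization.Theorems.FrustratedLawDichotomyStrainedPatchHomForceJacN (fjQ boxLabels11 boxLabels11_toFinset)
open Summit.AtomisticToContinuum.Crystallization.Theorems.FrustratedLawDichotomyStrainedPatchHomForceHcp (xiBallOK norm_le_quarter_of_xiBallOK)
open Summit.AtomisticToContinuum.Crystallization.Theorems.FrustratedLawDichotomyStrainedPatchHomSlopeLJAffine (affShuf abs_affShuf_sub_le jw)
open Summit.AtomisticToContinuum.Crystallization.Theorems.FrustratedLawDichotomyStrainedPatchHomEntryLeafHT (htBU htRU htUniv htIn htK htROKU htBU_nodup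
  htNaiOKA2 htGsA2 refForce_chunkA2_le jacOK jacOK_spec norm_le_seven_of_htIn lo_le_of_norm_le_seven six_le_norm_of_lo seven_lt_norm_of_not_mem_htUniv
  mem_boxLabels11_of_mem_htUniv mem_htUniv_of_mem_htBU htIn_of_mem_htBU mem_htBU_of_htIn)

/-! ## §1 Interval arithmetic of one ray-point coordinate -/

/-- The ray point's coordinate as a convex combination. [arithmetic] -/
theorem rayPoint_coord (ξ₀ ξ : E3) (a : ℝ) (j : Fin 3) : (ξ₀ + a • (ξ - ξ₀)) j = (1 - a) * ξ₀ j + a * ξ j := by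
  simp only [PiLp.add_apply, PiLp.smul_apply, PiLp.sub_apply, smul_eq_mul]; ring

/-- Scaled form of a coordinate box condition: `|x − c/SC| ≤ w/SC ⟹ c − w ≤ x·SC ≤ c + w`. [arithmetic] -/
theorem mulSC_bounds_of_abs_le {x : ℝ} {c w : ℤ} (h : |x - (c : ℝ) / SC| ≤ (w : ℝ) / SC) : (c : ℝ) - w ≤ x * SC ∧ x * SC ≤ c + w := by
  have hS : (0 : ℝ) < SC := SC_pos
  have e : x - (c : ℝ) / SC = (x * SC - c) / SC := by field_simp
  rw [e, abs_div, abs_of_pos hS, div_le_div_iff_of_pos_right hS, abs_le] at h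
  constructor <;> linarith [h.1, h.2]

/-- Converse scaled form: `c − w ≤ v·SC ≤ c + w ⟹ |v − c/SC| ≤ w/SC`. [arithmetic] -/
theorem abs_le_of_mulSC_bounds {v : ℝ} {c w : ℤ} (h1 : (c : ℝ) - w ≤ v * SC) (h2 : v * SC ≤ c + w) : |v - (c : ℝ) / SC| ≤ (w : ℝ) / SC := by
  have hS : (0 : ℝ) < SC := SC_pos
  have e : v - (c : ℝ) / SC = (v * SC - c) / SC := by field_simp
  rw [e, abs_div, abs_of_pos hS, div_le_div_iff_of_pos_right hS, abs_le]
  constructor <;> linarith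

/-- Strict exterior form: `v·SC < c − w` or `c + w < v·SC` ⟹ `w/SC < |v − c/SC|`. [arithmetic] -/
theorem lt_abs_of_mulSC_out {v : ℝ} {c w : ℤ} (h : v * SC < (c : ℝ) - w ∨ (c : ℝ) + w < v * SC) : (w : ℝ) / SC < |v - (c : ℝ) / SC| := by
  have hS : (0 : ℝ) < SC := SC_pos
  have e : v - (c : ℝ) / SC = (v * SC - c) / SC := by field_simp
  rw [e, abs_div, abs_of_pos hS, div_lt_div_iff_of_pos_right hS, lt_abs]
  rcases h with h | h
  · right; linarith
  · left; linarith

/-- ★ **CERTIFIED MEMBERSHIP of a ray-point coordinate**: `ξ₀ j ∈ [cC ∓ wC]/SC`, `ξ j ∈ [c ∓ w]/SC`, `0 ≤ na ≤ den`, `0 < den`, and the integer check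
`den(cs − ws) ≤ (den − na)(cC − wC) + na(c − w)`, `(den − na)(cC + wC) + na(c + w) ≤ den(cs + ws)` ⟹ `|(ray (na/den)) j − cs/SC| ≤ ws/SC`. [arithmetic] -/
theorem ray_coord_mem_of_check {x x₀ : ℝ} {cC wC c w cs ws na den : ℤ} (hx₀ : |x₀ - (cC : ℝ) / SC| ≤ (wC : ℝ) / SC) (hx : |x - (c : ℝ) / SC| ≤ (w : ℝ) / SC)
    (hden : 0 < den) (hna0 : 0 ≤ na) (hna1 : na ≤ den)
    (hlo : den * (cs - ws) ≤ (den - na) * (cC - wC) + na * (c - w)) (hhi : (den - na) * (cC + wC) + na * (c + w) ≤ den * (cs + ws)) :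
    |((1 - (na : ℝ) / den) * x₀ + (na : ℝ) / den * x) - (cs : ℝ) / SC| ≤ (ws : ℝ) / SC := by
  have hd : (0 : ℝ) < den := by exact_mod_cast hden
  obtain ⟨e2, e1⟩ := mulSC_bounds_of_abs_le hx₀
  obtain ⟨e4, e3⟩ := mulSC_bounds_of_abs_le hx
  have hlo' : (den : ℝ) * (cs - ws) ≤ (den - na) * (cC - wC) + na * (c - w) := by exact_mod_cast hlo
  have hhi' : ((den : ℝ) - na) * (cC + wC) + na * (c + w) ≤ den * (cs + ws) := by exact_mod_cast hhi
  have hna0' : (0 : ℝ) ≤ na := by exact_mod_cast hna0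
  have hna1r : (na : ℝ) ≤ den := by exact_mod_cast hna1
  have hna1' : (0 : ℝ) ≤ den - na := by linarith
  have ex : ((1 - (na : ℝ) / den) * x₀ + (na : ℝ) / den * x) * SC = ((den - na) * (x₀ * SC) + na * (x * SC)) / den := by
    field_simp
  apply abs_le_of_mulSC_bounds
  · rw [ex, le_div_iff₀ hd]
    nlinarith [mul_le_mul_of_nonneg_left e2 hna1', mul_le_mul_of_nonneg_left e4 hna0']
  · rw [ex, div_le_iff₀ hd]
    nlinarith [mul_le_mul_of_nonneg_left e1 hna1', mul_le_mul_of_nonneg_left e3 hna0']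

/-- ★ **CERTIFIED NON-MEMBERSHIP of a ray-point coordinate**: as above but the certified interval lies strictly OUTSIDE `[cs ∓ ws]/SC` on this coordinate
(`(den − nb)(cC + wC) + nb(c + w) < den(cs − ws)` or `den(cs + ws) < (den − nb)(cC − wC) + nb(c − w)`) ⟹ `ws/SC < |(ray (nb/den)) j − cs/SC|`. [arithmetic] -/
theorem ray_coord_not_mem_of_check {x x₀ : ℝ} {cC wC c w cs ws nb den : ℤ} (hx₀ : |x₀ - (cC : ℝ) / SC| ≤ (wC : ℝ) / SC) (hx : |x - (c : ℝ) / SC| ≤ (w : ℝ) / SC)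
    (hden : 0 < den) (hnb0 : 0 ≤ nb) (hnb1 : nb ≤ den)
    (hout : (den - nb) * (cC + wC) + nb * (c + w) < den * (cs - ws) ∨ den * (cs + ws) < (den - nb) * (cC - wC) + nb * (c - w)) :
    (ws : ℝ) / SC < |((1 - (nb : ℝ) / den) * x₀ + (nb : ℝ) / den * x) - (cs : ℝ) / SC| := by
  have hd : (0 : ℝ) < den := by exact_mod_cast hden
  obtain ⟨e2, e1⟩ := mulSC_bounds_of_abs_le hx₀
  obtain ⟨e4, e3⟩ := mulSC_bounds_of_abs_le hx
  have hnb0' : (0 : ℝ) ≤ nb := by exact_mod_cast hnb0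
  have hnb1r : (nb : ℝ) ≤ den := by exact_mod_cast hnb1
  have hnb1' : (0 : ℝ) ≤ den - nb := by linarith
  have ex : ((1 - (nb : ℝ) / den) * x₀ + (nb : ℝ) / den * x) * SC = ((den - nb) * (x₀ * SC) + nb * (x * SC)) / den := by
    field_simp
  apply lt_abs_of_mulSC_out
  rcases hout with h | h
  · left
    have h' : ((den : ℝ) - nb) * (cC + wC) + nb * (c + w) < den * (cs - ws) := by exact_mod_cast h
    rw [ex, div_lt_iff₀ hd]
    nlinarith [mul_le_mul_of_nonneg_left e1 hnb1', mul_le_mul_of_nonneg_left e3 hnb0']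
  · right
    have h' : (den : ℝ) * (cs + ws) < (den - nb) * (cC - wC) + nb * (c - w) := by exact_mod_cast h
    rw [ex, lt_div_iff₀ hd]
    nlinarith [mul_le_mul_of_nonneg_left e2 hnb1', mul_le_mul_of_nonneg_left e4 hnb0']

/-! ## §2 The dwell data and the signed floor sum in integers -/

/-- List accessor with default `0`. -/
def zAt (l : List ℤ) (k : ℕ) : ℤ := l.getD k 0

/-- The integer summand `sgnFloorZ ℓ a b a' b'` (= `sgnFloor` on numerators). -/
def sgnFloorZ (ℓ a b a' b' : ℤ) : ℤ := if 0 ≤ ℓ then ℓ * max 0 (a' - b) else ℓ * (b' - a)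

/-- Cast of `sgnFloorZ`: `sgnFloorZ ℓ … / (SC·den) = sgnFloor (ℓ/SC) (a/den) …`. [arithmetic] -/
theorem sgnFloorZ_cast (ℓ a b a' b' : ℤ) {den : ℤ} (hden : 0 < den) :
    sgnFloor ((ℓ : ℝ) / SC) ((a : ℝ) / den) ((b : ℝ) / den) ((a' : ℝ) / den) ((b' : ℝ) / den) = (sgnFloorZ ℓ a b a' b' : ℝ) / (SC * den) := by
  have hS : (0 : ℝ) < SC := SC_pos
  have hd : (0 : ℝ) < den := by exact_mod_cast hden
  unfold sgnFloor sgnFloorZ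
  have hsgn : (0 ≤ (ℓ : ℝ) / SC) ↔ (0 ≤ ℓ) := by
    rw [le_div_iff₀ hS, zero_mul]; exact_mod_cast Iff.rfl
  by_cases hℓ : 0 ≤ ℓ
  · rw [if_pos (hsgn.2 hℓ), if_pos hℓ]
    have hm : max 0 ((a' : ℝ) / den - (b : ℝ) / den) = ((max 0 (a' - b) : ℤ) : ℝ) / den := by
      rw [div_sub_div_same]
      rcases le_total 0 (a' - b) with h | h
      · rw [max_eq_right h, max_eq_right (div_nonneg (by exact_mod_cast h) hd.le)]; push_cast; ring
      · rw [max_eq_left h, max_eq_left (div_nonpos_of_nonpos_of_nonneg (by exact_mod_cast h) hd.le)]; simp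
    rw [hm]; push_cast; field_simp
  · rw [if_neg (fun h => hℓ (hsgn.1 h)), if_neg hℓ]
    push_cast; field_simp

/-- The dwell checks for the interior break points `1 ≤ k ≤ m − 1` and the end conventions. -/
def dwellOK (cC wC : Bx) (ch : List (Bx × Bx × (Fin 3 → Fin 3 → ℤ) × ℤ)) (den : ℤ) (na nb : List ℤ) (c w : Bx) : Bool :=
  decide (0 < den) && decide (zAt na 0 = 0) && decide (zAt nb 0 = 0) && decide (zAt na ch.length = den) && decide (zAt nb ch.length = den) &&
  (List.range ch.length).all fun k => decide (1 ≤ k) →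
    (decide (0 ≤ zAt na k) && decide (zAt na k ≤ den) && decide (0 ≤ zAt nb k) && decide (zAt nb k ≤ den) &&
      decide (∀ j : Fin 3, den * (chC ch (k - 1) (Sum.inr j) - chW ch (k - 1) (Sum.inr j)) ≤
          (den - zAt na k) * (cC (Sum.inr j) - wC (Sum.inr j)) + zAt na k * (c (Sum.inr j) - w (Sum.inr j)) ∧
        (den - zAt na k) * (cC (Sum.inr j) + wC (Sum.inr j)) + zAt na k * (c (Sum.inr j) + w (Sum.inr j)) ≤
          den * (chC ch (k - 1) (Sum.inr j) + chW ch (k - 1) (Sum.inr j))) &&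
      decide (∃ j : Fin 3, (den - zAt nb k) * (cC (Sum.inr j) + wC (Sum.inr j)) + zAt nb k * (c (Sum.inr j) + w (Sum.inr j)) <
          den * (chC ch (k - 1) (Sum.inr j) - chW ch (k - 1) (Sum.inr j)) ∨
        den * (chC ch (k - 1) (Sum.inr j) + chW ch (k - 1) (Sum.inr j)) <
          (den - zAt nb k) * (cC (Sum.inr j) - wC (Sum.inr j)) + zAt nb k * (c (Sum.inr j) - w (Sum.inr j))))

/-- The per-box signed chain check: curvature certificate over the hull label list + Gershgorin floor at the box's own `ll k`. -/
def annChainOK (B : List (Fin 3 → ℤ)) (ch : List (Bx × Bx × (Fin 3 → Fin 3 → ℤ) × ℤ)) (ll : List ℤ) : Bool :=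
  (List.range ch.length).all fun k =>
    curvCheckLJM (chC ch k) (chW ch k) (B.filter fun b => ljLabelOK (chC ch k) (chW ch k) b) (B.filter fun b => !ljLabelOK (chC ch k) (chW ch k) b)
      (chD ch k) (chL ch k) && gersh3 (chD ch k) (chL ch k) (zAt ll k)

/-- The integer signed floor sum `Σ_{k<m} sgnFloorZ (ll k) (na k) (nb k) (na (k+1)) (nb (k+1))`. -/
def sgnSumZ (ll na nb : List ℤ) (m : ℕ) : ℤ :=
  ∑ k ∈ Finset.range m, sgnFloorZ (zAt ll k) (zAt na k) (zAt nb k) (zAt na (k + 1)) (zAt nb (k + 1))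

/-! ## §3 ★★★ The annulus / signed exterior leaf and its soundness -/

/-- ★★★ **THE SIGNED-FLOOR EXTERIOR LEAF** (annulus (β)): `exteriorOK`'s fields with per-box floors `ll`, dwell data `(den, na, nb)` and the length-weighted domination. -/
def annulusOK (J : Fin 3 → Fin 3 × Fin 3 → ℤ) (cC wC cH wH : Bx) (ch : List (Bx × Bx × (Fin 3 → Fin 3 → ℤ) × ℤ)) (ll : List ℤ) (den : ℤ) (na nb : List ℤ)
    (g : ℤ) (i : Fin 3) (c w : Bx) : Bool :=
  sameU c w cC wC && sameU c w cH wH && xiBallOK cH wH && jacOK J wC && decide (htK cH wH < (SC : ℤ)) && htROKU cH wH &&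
  htNaiOKA2 cC wC J (htBU cH wH) && decide (0 < ch.length) && annChainOK (htBU cH wH) ch ll && extGeomOK cC wC ch c w &&
  xiSub cC wC cH wH && xiSub c w cH wH && decide (0 < g) &&
  decide (cC (Sum.inr i) + wC (Sum.inr i) + g ≤ c (Sum.inr i) - w (Sum.inr i) ∨ c (Sum.inr i) + w (Sum.inr i) + g ≤ cC (Sum.inr i) - wC (Sum.inr i)) &&
  dwellOK cC wC ch den na nb c w &&
  decide (0 < sgnSumZ ll na nb ch.length) &&
  decide (4 * (SC : ℤ) ^ 2 * den * 8892 * 279936 + 4 * (SC : ℤ) * den * htGsA2 cC wC J (htBU cH wH) * 230539333248 +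
      4 * (SC : ℤ) ^ 2 * den * ((htRU cH wH).length : ℤ) * 823543 < 3 * g * 230539333248 * sgnSumZ ll na nb ch.length)

/-- ★★★ **SOUNDNESS OF THE SIGNED-FLOOR EXTERIOR LEAF in the full `hver` shape, at EVERY level `μ`.** [folklore chaining: as `exteriorOK_sound`, ending in
`hver_exterior_of_curvChecks_signedFloor` with `ℓlo k := ll k/SC`, `a k := na k/den`, `b k := nb k/den`] -/
theorem annulusOK_sound {μ : ℤ} {J : Fin 3 → Fin 3 × Fin 3 → ℤ} {cC wC cH wH : Bx} {ch : List (Bx × Bx × (Fin 3 → Fin 3 → ℤ) × ℤ)} {ll : List ℤ} {den : ℤ}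
    {na nb : List ℤ} {g : ℤ} {i : Fin 3} {c w : Bx} (h : annulusOK J cC wC cH wH ch ll den na nb g i c w = true) (U : E3 →L[ℝ] E3) (ξ : E3)
    (_hsa : ∀ v v' : E3, ⟪U v, v'⟫ = ⟪v, U v'⟫) (hU : ‖U - 1‖ ≤ 1 / 4)
    (hbox : ∀ ab : Fin 3 × Fin 3, |(U (EuclideanSpace.single ab.2 (1 : ℝ))) ab.1 - (c (Sum.inl ab) : ℝ) / SC| ≤ (w (Sum.inl ab) : ℝ) / SC)
    (hξ : ∀ i : Fin 3, |ξ i - (c (Sum.inr i) : ℝ) / SC| ≤ (w (Sum.inr i) : ℝ) / SC) (_h0 : 0 ≤ ξ 0) (_h2 : 0 ≤ ξ 2) :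
    (∀ (M : ℕ) (z : Fin M → E3) (cc : Fin M), Function.Injective z →
        Set.range z = {x : E3 | dist x (z cc) ≤ 133 / 10 ∧ ∃ a : Fin 3 → ℤ,
          x = z cc + latPt U hexFrame a ∨ x = z cc + latPt U hexFrame a + U (hcpShift + ξ)} →
        TightNearCap (9 / 5) (3 / 2) z cc ∨ ExemptNear (9 / 5) ExRec z cc ∨ BadNearCap (9 / 5) (3 / 2) z cc) ∨
      (μ : ℝ) / SC ≤ ∑ b ∈ (Fintype.piFinset fun _ : Fin 3 => Finset.Icc (-7 : ℤ) 7).filter (fun b => b ≠ 0), effPot w₄₅ ω₄ (3 / 400) ‖latPt U hexFrame b‖ +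
        ∑ b ∈ (Fintype.piFinset fun _ : Fin 3 => Finset.Icc (-7 : ℤ) 7), effPot w₄₅ ω₄ (3 / 400) ‖latPt U hexFrame b + U (hcpShift + ξ)‖ := by
  classical
  have hS : (0 : ℝ) < SC := SC_pos
  unfold annulusOK at h
  simp only [Bool.and_eq_true, decide_eq_true_eq] at h
  obtain ⟨⟨⟨⟨⟨⟨⟨⟨⟨⟨⟨⟨⟨⟨⟨⟨hUC, hUH⟩, hball⟩, hjac⟩, hKlt⟩, hROK⟩, hNai⟩, hlen⟩, hchain⟩, hgeom⟩, hCH⟩, hSH⟩, hg⟩, hgap⟩, hdwell⟩, hpos⟩, hdomZ⟩ := h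
  have hboxC := hbox_of_sameU hUC hbox
  have hboxH := hbox_of_sameU hUH hbox
  set ξ₀ : E3 := affShuf J cC U with hξ₀def
  have hξ₀C : ∀ m : Fin 3, |ξ₀ m - (cC (Sum.inr m) : ℝ) / SC| ≤ (wC (Sum.inr m) : ℝ) / SC := by
    intro m
    refine (abs_affShuf_sub_le (J := J) (w := wC) U hboxC m).trans ?_
    rw [div_le_div_iff_of_pos_right hS]
    exact_mod_cast jacOK_spec hjac m
  have hξ₀H := hxi_of_xiSub hCH hξ₀C
  have hξH := hxi_of_xiSub hSH hξ
  have hn₀ : ‖ξ₀‖ ≤ 1 / 4 := norm_le_quarter_of_xiBallOK hball hξ₀H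
  have hn : ‖ξ‖ ≤ 1 / 4 := norm_le_quarter_of_xiBallOK hball hξH
  set B : Finset (Fin 3 → ℤ) := (htBU cH wH).toFinset with hBdef
  set R : Finset (Fin 3 → ℤ) := (htRU cH wH).toFinset with hRdef
  have hB : B ⊆ Fintype.piFinset fun _ : Fin 3 => Finset.Icc (-11 : ℤ) 11 := by
    intro b hb
    rw [← boxLabels11_toFinset]
    exact List.mem_toFinset.2 (mem_boxLabels11_of_mem_htUniv (mem_htUniv_of_mem_htBU (List.mem_toFinset.1 hb)))
  have hBin : ∀ bb ∈ B, ‖latPt U hexFrame bb + U (hcpShift + ξ)‖ ≤ 7 :=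
    fun bb hbb => norm_le_seven_of_htIn U hboxH ξ hξH (htIn_of_mem_htBU (List.mem_toFinset.1 hbb))
  have hROK' : ∀ b ∈ htRU cH wH, 36 * (SC : ℤ) ≤ (fjQ cH wH b).lo := by
    intro b hb
    have := List.all_eq_true.1 hROK b hb
    simpa using this
  have hR : ∀ bb ∈ (Fintype.piFinset fun _ : Fin 3 => Finset.Icc (-11 : ℤ) 11) \ B, ‖latPt U hexFrame bb + U (hcpShift + ξ)‖ ≤ 7 →
      bb ∈ R ∧ 6 ≤ ‖latPt U hexFrame bb + U (hcpShift + ξ)‖ := by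
    intro bb hbb h7
    obtain ⟨hbox11, hnotB⟩ := Finset.mem_sdiff.1 hbb
    rw [← boxLabels11_toFinset] at hbox11
    have hbL : bb ∈ boxLabels11 := List.mem_toFinset.1 hbox11
    have hlo := lo_le_of_norm_le_seven U hboxH ξ hξH h7
    by_cases huniv : bb ∈ htUniv cH wH
    swap
    · exact absurd h7 (not_le.2 (seven_lt_norm_of_not_mem_htUniv U hboxH hξH hKlt hbL huniv))
    by_cases hin : htIn cH wH bb = true
    · exact absurd (List.mem_toFinset.2 (mem_htBU_of_htIn huniv hin)) hnotB
    · have hmemR : bb ∈ htRU cH wH := by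
        refine List.mem_filter.2 ⟨huniv, ?_⟩
        simp only [Bool.and_eq_true, Bool.not_eq_true', decide_eq_true_eq]
        exact ⟨by simpa using hin, hlo⟩
      exact ⟨List.mem_toFinset.2 hmemR, six_le_norm_of_lo U hboxH ξ hξH (hROK' bb hmemR)⟩
  have hf₀ := refForce_chunkA2_le (htBU_nodup cH wH) hNai U hU hboxC (by simpa [hξ₀def] using hn₀) ξ
  rw [← hBdef] at hf₀
  set m : ℕ := ch.length with hmdef
  have hm : 0 < m := hlen
  simp only [annChainOK, List.all_eq_true, List.mem_range, Bool.and_eq_true] at hchain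
  simp only [extGeomOK, List.all_eq_true, List.mem_range, Bool.and_eq_true, decide_eq_true_eq] at hgeom
  obtain ⟨⟨⟨hsameK, hC0⟩, hSlast⟩, hnestK⟩ := hgeom
  have hLB : ∀ k, k < m → ((htBU cH wH).filter (fun b => ljLabelOK (chC ch k) (chW ch k) b) ++
      (htBU cH wH).filter (fun b => !ljLabelOK (chC ch k) (chW ch k) b)).toFinset = B :=
    fun k _ => by rw [hBdef]; exact toFinset_filter_append _ _
  have hnd : ∀ k, k < m → ((htBU cH wH).filter (fun b => ljLabelOK (chC ch k) (chW ch k) b) ++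
      (htBU cH wH).filter (fun b => !ljLabelOK (chC ch k) (chW ch k) b)).Nodup :=
    fun k _ => nodup_filter_append (htBU_nodup cH wH) _
  have hchk : ∀ k, k < m → curvCheckLJM (chC ch k) (chW ch k) ((htBU cH wH).filter fun b => ljLabelOK (chC ch k) (chW ch k) b)
      ((htBU cH wH).filter fun b => !ljLabelOK (chC ch k) (chW ch k) b) (chD ch k) (chL ch k) = true :=
    fun k hk => (hchain k hk).1
  have hUbox : ∀ k, k < m → ∀ ab : Fin 3 × Fin 3,
      |(U (EuclideanSpace.single ab.2 (1 : ℝ))) ab.1 - (chC ch k (Sum.inl ab) : ℝ) / SC| ≤ (chW ch k (Sum.inl ab) : ℝ) / SC :=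
    fun k hk => hbox_of_sameU (hsameK k hk) hbox
  have hnest : ∀ k, k + 1 < m → ∀ j : Fin 3, chC ch (k + 1) (Sum.inr j) - chW ch (k + 1) (Sum.inr j) ≤ chC ch k (Sum.inr j) - chW ch k (Sum.inr j) ∧
      chC ch k (Sum.inr j) + chW ch k (Sum.inr j) ≤ chC ch (k + 1) (Sum.inr j) + chW ch (k + 1) (Sum.inr j) := by
    intro k hk j
    have h' := hnestK k (by omega) hk
    simp only [xiSub, decide_eq_true_eq] at h'
    exact h' j
  have h0 := hxi_of_xiSub hC0 hξ₀C
  have h1 := hxi_of_xiSub hSlast hξ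
  have hΔ : U (ξ - ξ₀) ≠ 0 := U_sub_ne_zero_of_gap hU i hg hξ hξ₀C hgap
  -- per-box signed floors
  have hℓ : ∀ k, k < m → ((zAt ll k : ℝ) / SC) * ‖U (ξ - ξ₀)‖ ^ 2 ≤
      (chL ch k : ℝ) / SC * ‖U (ξ - ξ₀)‖ ^ 2 + ∑ i : Fin 3, ∑ j : Fin 3, (chD ch k i j : ℝ) / SC * ((U (ξ - ξ₀)) i * (U (ξ - ξ₀)) j) :=
    fun k hk => gersh3_sound (hchain k hk).2 _
  -- dwell data
  simp only [dwellOK, Bool.and_eq_true, decide_eq_true_eq, List.all_eq_true, List.mem_range] at hdwell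
  obtain ⟨⟨⟨⟨⟨hden, hna0⟩, hnb0⟩, hnam⟩, hnbm⟩, hdw⟩ := hdwell
  have hd : (0 : ℝ) < den := by exact_mod_cast hden
  set a : ℕ → ℝ := fun k => (zAt na k : ℝ) / den with hadef
  set b : ℕ → ℝ := fun k => (zAt nb k : ℝ) / den with hbdef
  have ha0 : a 0 = 0 := by show (zAt na 0 : ℝ) / den = 0; rw [hna0]; simp
  have hb0 : b 0 = 0 := by show (zAt nb 0 : ℝ) / den = 0; rw [hnb0]; simp
  have ham : a m = 1 := by show (zAt na m : ℝ) / den = 1; rw [hnam]; exact div_self hd.ne'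
  have hbm : b m = 1 := by show (zAt nb m : ℝ) / den = 1; rw [hnbm]; exact div_self hd.ne'
  have ha : ∀ k, 1 ≤ k → k < m → a k ∈ Icc (0 : ℝ) 1 ∧
      ∀ j : Fin 3, |(ξ₀ + a k • (ξ - ξ₀)) j - (chC ch (k - 1) (Sum.inr j) : ℝ) / SC| ≤ (chW ch (k - 1) (Sum.inr j) : ℝ) / SC := by
    intro k hk1 hkm
    obtain ⟨⟨⟨⟨⟨hn0, hn1⟩, hm0⟩, hm1⟩, hmem⟩, _⟩ := hdw k hkm hk1
    refine ⟨⟨div_nonneg (by exact_mod_cast hn0) hd.le, (div_le_one hd).2 (by exact_mod_cast hn1)⟩, fun j => ?_⟩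
    rw [rayPoint_coord]
    exact ray_coord_mem_of_check (hξ₀C j) (hξ j) hden hn0 hn1 (hmem j).1 (hmem j).2
  have hb : ∀ k, 1 ≤ k → k < m → b k ∈ Icc (0 : ℝ) 1 ∧
      ∃ j : Fin 3, (chW ch (k - 1) (Sum.inr j) : ℝ) / SC < |(ξ₀ + b k • (ξ - ξ₀)) j - (chC ch (k - 1) (Sum.inr j) : ℝ) / SC| := by
    intro k hk1 hkm
    obtain ⟨⟨⟨⟨⟨_, _⟩, hm0⟩, hm1⟩, _⟩, ⟨j, hj⟩⟩ := hdw k hkm hk1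
    refine ⟨⟨div_nonneg (by exact_mod_cast hm0) hd.le, (div_le_one hd).2 (by exact_mod_cast hm1)⟩, j, ?_⟩
    rw [rayPoint_coord]
    exact ray_coord_not_mem_of_check (hξ₀C j) (hξ j) hden hm0 hm1 hj
  -- the domination
  have hRcard : (R.card : ℝ) ≤ ((htRU cH wH).length : ℝ) := by
    rw [hRdef]; exact_mod_cast List.toFinset_card_le _
  have hS7 : (6000 / 343 * (7 : ℝ)⁻¹ ^ 4 + 2880 / 49 * (7 : ℝ)⁻¹ ^ 5 + 10 / 7 * (7 : ℝ)⁻¹ ^ 6 + 2 * (7 : ℝ)⁻¹ ^ 7) = 8892 / 823543 := by norm_num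
  have h67 : ((6 : ℝ)⁻¹ ^ 7) = 1 / 279936 := by norm_num
  have hsum : (∑ k ∈ Finset.range m, sgnFloor ((zAt ll k : ℝ) / SC) (a k) (b k) (a (k + 1)) (b (k + 1))) =
      (sgnSumZ ll na nb m : ℝ) / (SC * den) := by
    simp only [hadef, hbdef, sgnSumZ]
    push_cast
    rw [Finset.sum_div]
    exact Finset.sum_congr rfl fun k _ => sgnFloorZ_cast _ _ _ _ _ hden
  have hZ : (4 * (SC : ℝ) ^ 2 * den * 8892 * 279936 + 4 * (SC : ℝ) * den * (htGsA2 cC wC J (htBU cH wH) : ℝ) * 230539333248 +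
      4 * (SC : ℝ) ^ 2 * den * ((htRU cH wH).length : ℝ) * 823543) < 3 * (g : ℝ) * 230539333248 * (sgnSumZ ll na nb m : ℝ) := by
    exact_mod_cast hdomZ
  have hposR : (0 : ℝ) < (sgnSumZ ll na nb m : ℝ) := by exact_mod_cast hpos
  have hdom : (6000 / 343 * (7 : ℝ)⁻¹ ^ 4 + 2880 / 49 * (7 : ℝ)⁻¹ ^ 5 + 10 / 7 * (7 : ℝ)⁻¹ ^ 6 + 2 * (7 : ℝ)⁻¹ ^ 7) +
      (htGsA2 cC wC J (htBU cH wH) : ℝ) / SC + R.card * (6 : ℝ)⁻¹ ^ 7 <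
      (∑ k ∈ Finset.range m, sgnFloor ((zAt ll k : ℝ) / SC) (a k) (b k) (a (k + 1)) (b (k + 1))) * ‖U (ξ - ξ₀)‖ := by
    rw [hsum, hS7, h67]
    have hρ := norm_U_sub_ge_of_gap hU i hξ hξ₀C hgap
    have hSC : (SC : ℝ) = 281474976710656 := by norm_num [SC]
    have hΛpos : (0 : ℝ) < (sgnSumZ ll na nb m : ℝ) / (SC * den) := div_pos hposR (mul_pos hS hd)
    have hstep : (8892 : ℝ) / 823543 + (htGsA2 cC wC J (htBU cH wH) : ℝ) / SC + ((htRU cH wH).length : ℝ) * (1 / 279936) <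
        (sgnSumZ ll na nb m : ℝ) / (SC * den) * (3 / 4 * ((g : ℝ) / SC)) := by
      rw [← sub_pos]
      have e : (sgnSumZ ll na nb m : ℝ) / (SC * den) * (3 / 4 * ((g : ℝ) / SC)) -
          ((8892 : ℝ) / 823543 + (htGsA2 cC wC J (htBU cH wH) : ℝ) / SC + ((htRU cH wH).length : ℝ) * (1 / 279936)) =
          (3 * (g : ℝ) * 230539333248 * (sgnSumZ ll na nb m : ℝ) - (4 * (SC : ℝ) ^ 2 * den * 8892 * 279936 +
            4 * (SC : ℝ) * den * (htGsA2 cC wC J (htBU cH wH) : ℝ) * 230539333248 + 4 * (SC : ℝ) ^ 2 * den * ((htRU cH wH).length : ℝ) * 823543)) /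
            (4 * (SC : ℝ) ^ 2 * den * 230539333248) := by
        field_simp
        ring
      rw [e]
      exact div_pos (by linarith) (by positivity)
    have hR67 : (R.card : ℝ) * (1 / 279936) ≤ ((htRU cH wH).length : ℝ) * (1 / 279936) := mul_le_mul_of_nonneg_right hRcard (by norm_num)
    calc (8892 : ℝ) / 823543 + (htGsA2 cC wC J (htBU cH wH) : ℝ) / SC + R.card * (1 / 279936)
        ≤ (8892 : ℝ) / 823543 + (htGsA2 cC wC J (htBU cH wH) : ℝ) / SC + ((htRU cH wH).length : ℝ) * (1 / 279936) := by linarith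
      _ < (sgnSumZ ll na nb m : ℝ) / (SC * den) * (3 / 4 * ((g : ℝ) / SC)) := hstep
      _ ≤ (sgnSumZ ll na nb m : ℝ) / (SC * den) * ‖U (ξ - ξ₀)‖ := mul_le_mul_of_nonneg_left hρ hΛpos.le
  exact hver_exterior_of_curvChecks_signedFloor (μ := μ) hU hn₀ hn B R hB hBin hR hf₀ m hm (chC ch) (chW ch)
    (fun k => (htBU cH wH).filter fun b => ljLabelOK (chC ch k) (chW ch k) b) (fun k => (htBU cH wH).filter fun b => !ljLabelOK (chC ch k) (chW ch k) b)
    (chD ch) (chL ch) hLB hnd hchk hUbox hnest h0 h1 hΔ (fun k => (zAt ll k : ℝ) / SC) hℓ a b ha0 hb0 ham hbm ha hb hdom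

end Summit.AtomisticToContinuum.Crystallization.Theorems.FrustratedLawDichotomyStrainedPatchHomExteriorRay

end
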